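/-
Copyright (c) 2026 the pub-hodgecm-mathlib formalisation cell (harness21).  Prover seat hodgecm-mathlib-K2E1-p10 (g3), Track B ∕ K2-LIT (build stream 29), h413 = `stmt-HodgeConjecture-24833`,
route of record `HCCMUnconditional`, AMENDMENT #3 «GENERAL (U,τ) LADDER» rung C.1, C7_τ FILE P1b_τ; dealer K2E1-plan (g7) deal (269): the `τ`-TWISTED twin of ★ P1b `K2E1PseudoEisensteinNiceGeneratorsU`
— ★ F2b_τ's head with the NICE generating class (continuous, bounded, compactly supported modulo the radical, `τ`-equivariant test functions).
-/
import Summits.HodgeConjecture.HodgeConjecture.Theorems.K2E1PseudoEisensteinNiceGeneratorsU     -- ★ P1b (this lineage): `topologicalClosure_span_le_nice`; brings ★ P1a `continuous_average`, …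
import Summits.HodgeConjecture.HodgeConjecture.Theorems.K2E1PseudoEisensteinKTypeAverageU2     -- ★ F2b_τ (this seat): `integral_smul_rightRegular_toLp_pseudoEisenstein_eq`, `tauAverage_mul_left`, …
import HarnessLib

/-!
# h413 ∕ Track B «K2-LIT», AMENDMENT #3 C.1, C7_τ FILE P1b_τ — helper `K2E1PseudoEisensteinNiceGeneratorsKTypeU`: `Wᗮ ∩ L²(X)^{τ} = closure span {[θ_Ψ] : Ψ ∈ 𝒯_i CONTINUOUS, BOUNDED,
# Ψ = 0 off C·N_i(𝔸) (C compact), Ψ(ι(k)h) = τ(k)⁻¹ Ψ(h)}` — ★ F2b_τ's head with the NICE generating class (generic `𝒢`; any closed `R`-stable `W` with `Wᗮ = closure span {[θ_Φ] : Φ ∈ 𝒯_i}`)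

Cell `pub/hodgecm-mathlib`, crux h413 = `stmt-HodgeConjecture-24833`, route `HCCMUnconditional`; dealer K2E1-plan (g7) (269).  THEOREMS ONLY (no `def`, no `instance`, no notation, no named-fact
hypothesis, no `sorry`); lane `--supports stmt-HodgeConjecture-24833 --as helper` (count-neutral).  Closes no socket.  GENERIC over ★ `AdelicGroupData 𝒢` with closed radicals (`hN`), an
automorphic `μ`, a Haar measure `ν` on `G(𝔸)` (only for the smoothing inside ★ P1a), a compact group `(Kc, μK)` (topological group, compact, second countable, left-, right- and
inversion-invariant probability measure) mapped continuously into `G(𝔸)` by `ι`, and a continuous unitary character `τ : Kc →* ℂ` (the currency of ★ F1_τ ∕ ★ F2b_τ).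

THE MATHEMATICS (★ P1b with the twist).  `E := Wᗮ = closure span Θ` (`hE`) is also `closure span Θ^{nice}` (★ P1b §1, from ★ P1a: truncation + Dirac smoothing), so ★ F1_τ gives
`E ∩ L²(X)^{τ} = closure span (P_τ Θ^{nice})`, and `P_τ[θ_Φ] = [θ_{Φ^{♮,τ}}]` (★ F2b_τ) with `Φ^{♮,τ}(h) = ∫_K τ(k) Φ(ι(k)h) dμK` again NICE: continuous (§1 `continuous_tauAverage`), bounded
(`|τ| = 1`), vanishing off `(ι(K)⁻¹·C)·N_i(𝔸)`, and `τ`-EQUIVARIANT, `Φ^{♮,τ}(ι(k)h) = τ(k)⁻¹ Φ^{♮,τ}(h)` (★ F2b_τ `tauAverage_mul_left`); conversely the classes of nice `τ`-equivariant test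
functions are `τ`-vectors of `E` (★ F2b_τ `toLp_pseudoEisenstein_mem_iInf_eigenspace_of_forall`).  This is the generating class the `ω`-twisted family decomposition (★ F3d-β_τ, ★ F3d-ε_τ,
HEAD_τ) consumes: its members periodise to CONTINUOUS compactly supported `ω`-sections on `N(𝔸)B(F)∖G(𝔸)`.
* §1 `continuous_tauAverage`, `norm_tauAverage_le`, `tauAverage_eq_zero_of_forall` (the twisted average of a nice test function is nice).
* §2 **`orthogonal_inf_iInf_eigenspace_eq_topologicalClosure_span_nice`** (the head; the three sets enter through abbreviation hypotheses `hΘ`, `hΘn`, `hΘτn` — pass `rfl rfl rfl`).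

HONEST LABEL: HC_CM is proved only modulo the 7 printed citations (2 remaining named inputs: hLiu418 = `stmt-HodgeConjecture-24832`, h413 = `stmt-HodgeConjecture-24833`) until rung 0
closes; this file asserts no named fact and closes no socket.
References: [MoeglinWaldspurger1995] Mœglin–Waldspurger, *Spectral Decomposition and Eisenstein Series*, II.1.2–II.1.4, II.1.12; [DeitmarEchterhoff2014] Deitmar–Echterhoff, *Principles of
Harmonic Analysis* (2nd ed.), Lemma 6.2.2, Lemma 7.2.6; [Knapp1986] Knapp, *Representation Theory of Semisimple Groups*, VIII §3; [Folland1999] Folland, *Real Analysis*, Thm. 2.27.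
-/

set_option autoImplicit false
set_option linter.dupNamespace false  -- the mandated namespace repeats the summit's segment (`HodgeConjecture.HodgeConjecture`)

noncomputable section

open MeasureTheory Measure Set Filter Topology CompactlySupported
open Literature.MeasureTheory.Group Literature.NumberTheory.Automorphic ContRepresentation
open Summit.HodgeConjecture.HodgeConjecture.Cruxes.H413.K2E1PseudoEisensteinCuspOrthogonal (memLp_two_pseudoEisenstein_automorphicQuotient)
open Summit.HodgeConjecture.HodgeConjecture.Cruxes.H413.K2E1PseudoEisensteinNiceGeneratorsU (topologicalClosure_span_le_nice)
open Summit.HodgeConjecture.HodgeConjecture.Cruxes.H413.K2E1PseudoEisensteinKTypeAverageU2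
open Summit.HodgeConjecture.HodgeConjecture.Cruxes.H413.K2E1KTypeAverageProjectionU (inf_iInf_eigenspace_eq_topologicalClosure_span_image_tauAverage ne_zero_of_norm_eq_one)
open scoped ENNReal NNReal Pointwise

namespace Summit.HodgeConjecture.HodgeConjecture.Cruxes.H413.K2E1PseudoEisensteinNiceGeneratorsKTypeU

universe u

/-! ## §1 The twisted average of a nice test function is nice -/

section Average

variable {G : Type*} [Group G] [TopologicalSpace G] [IsTopologicalGroup G] [LocallyCompactSpace G] [FirstCountableTopology G]
  {Kc : Type*} [Group Kc] [TopologicalSpace Kc] [CompactSpace Kc] [MeasurableSpace Kc] [OpensMeasurableSpace Kc] (μK : Measure Kc) [IsFiniteMeasure μK] (τ : Kc →* ℂ)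

/-- **THE TWISTED AVERAGE OF A CONTINUOUS FUNCTION IS CONTINUOUS**: `h ↦ ∫_K τ(k) Φ(ι(k) h) dμK` for continuous `τ`, `ι`, `Φ` (Mathlib `continuous_parametric_integral_of_continuous` over the compact
`K`). [cite: Folland1999, Thm. 2.27] -/
theorem continuous_tauAverage {ι : Kc → G} (hι : Continuous ι) (hτc : Continuous τ) {Φ : G → ℂ} (hΦ : Continuous Φ) : Continuous fun h : G => ∫ k, τ k * Φ (ι k * h) ∂μK := by
  have h := continuous_parametric_integral_of_continuous (μ := μK) (f := fun (h : G) (k : Kc) => τ k * Φ (ι k * h))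
    ((hτc.comp continuous_snd).mul (hΦ.comp ((hι.comp continuous_snd).mul continuous_fst))) isCompact_univ
  simpa only [Measure.restrict_univ] using h

omit [TopologicalSpace G] [IsTopologicalGroup G] [LocallyCompactSpace G] [FirstCountableTopology G] [TopologicalSpace Kc] [CompactSpace Kc] [OpensMeasurableSpace Kc] in
/-- `|∫_K τ(k) Φ(ι(k) h) dμK| ≤ M` for a probability `μK`, `|τ| = 1` and `|Φ| ≤ M`. [cite: DeitmarEchterhoff2014, Lemma 7.2.6] -/
theorem norm_tauAverage_le [IsProbabilityMeasure μK] (ι : Kc → G) (hτ : ∀ k, ‖τ k‖ = 1) {Φ : G → ℂ} {M : ℝ} (hM : ∀ g, ‖Φ g‖ ≤ M) (h : G) : ‖∫ k, τ k * Φ (ι k * h) ∂μK‖ ≤ M :=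
  calc ‖∫ k, τ k * Φ (ι k * h) ∂μK‖ ≤ ∫ _k, M ∂μK :=
        norm_integral_le_of_norm_le (integrable_const M) (Eventually.of_forall fun k => by rw [norm_mul, hτ k, one_mul]; exact hM _)
    _ = M := by rw [integral_const, probReal_univ, one_smul]

omit [TopologicalSpace G] [IsTopologicalGroup G] [LocallyCompactSpace G] [FirstCountableTopology G] [TopologicalSpace Kc] [CompactSpace Kc] [OpensMeasurableSpace Kc] [IsFiniteMeasure μK] in
/-- **SUPPORT OF THE TWISTED AVERAGE**: if `Φ` vanishes off `S` then `∫_K τ(k) Φ(ι(k) h) dμK` vanishes off `(range ι)⁻¹·S`. [folklore] -/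
theorem tauAverage_eq_zero_of_forall (ι : Kc → G) {Φ : G → ℂ} {S : Set G} (hS : ∀ g, g ∉ S → Φ g = 0) {h : G} (hh : h ∉ (Set.range ι)⁻¹ * S) :
    (∫ k, τ k * Φ (ι k * h) ∂μK) = 0 := by
  refine integral_eq_zero_of_ae (Eventually.of_forall fun k => ?_)
  have hk : ι k * h ∉ S := fun hmem => hh ⟨(ι k)⁻¹, Set.inv_mem_inv.2 ⟨k, rfl⟩, ι k * h, hmem, by group⟩
  simp only [hS _ hk, mul_zero, Pi.zero_apply]

end Average

/-! ## §2 The head with the nice `τ`-equivariant generators -/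

section Head

variable {K : Type} [Field K] [NumberField K] (𝒢 : AdelicGroupData.{u} K)
  [MeasurableSpace 𝒢.Adelic] [BorelSpace 𝒢.Adelic] [LocallyCompactSpace 𝒢.Adelic] [SecondCountableTopology 𝒢.Adelic] [T2Space 𝒢.Adelic]
  [DiscreteTopology 𝒢.quotientSubgroup] (𝔓 : 𝒢.ParabolicUnipotentData)
  (μ : Measure 𝒢.automorphicQuotient) [𝒢.IsAutomorphicMeasure μ]
  (ν : Measure 𝒢.Adelic) [ν.IsHaarMeasure]
  {Kc : Type*} [Group Kc] [TopologicalSpace Kc] [IsTopologicalGroup Kc] [CompactSpace Kc] [SecondCountableTopology Kc] [MeasurableSpace Kc] [BorelSpace Kc]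
  (μK : Measure Kc) [IsProbabilityMeasure μK] [μK.IsMulLeftInvariant] [μK.IsMulRightInvariant] [μK.IsInvInvariant] (ι : Kc →* 𝒢.Adelic) (τ : Kc →* ℂ)

include ν μK in
/-- **`Wᗮ ∩ L²(X)^{τ} = closure span {[θ_Ψ] : Ψ ∈ 𝒯_i continuous, bounded, Ψ = 0 off C·N_i(𝔸) (C compact), Ψ(ι(k)h) = τ(k)⁻¹ Ψ(h)}`** for any closed `R`-stable `W` with `Wᗮ = closure span Θ` (`hE`;
`W = L²_cusp` by ★ f1), closed radicals (`hN`), a compact group `(Kc, μK) → G(𝔸)` and a continuous unitary character `τ`: ★ P1b §1 + ★ F1_τ + ★ F2b_τ (`P_τ[θ_Φ] = [θ_{Φ^{♮,τ}}]`) + §1 (`Φ^{♮,τ}` is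
again nice: continuous, bounded, vanishing off `(ι(K)⁻¹·C)·N_i(𝔸)`, and `τ`-equivariant by ★ F2b_τ `tauAverage_mul_left`) — the generating class of the `ω`-twisted family decomposition.  (Sets through
`hΘ hΘn hΘτn`: pass `rfl rfl rfl`.) [cite: MoeglinWaldspurger1995, II.1.2–II.1.4] [cite: DeitmarEchterhoff2014, Lemma 7.2.6] [cite: Knapp1986, VIII §3] -/
theorem orthogonal_inf_iInf_eigenspace_eq_topologicalClosure_span_nice (hN : ∀ i : 𝔓.ι, IsClosed ((𝔓.radical i : Subgroup 𝒢.Adelic) : Set 𝒢.Adelic)) (hι : Continuous ι)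
    (hτ : ∀ k, ‖τ k‖ = 1) (hτc : Continuous τ) (W : ClosedSubrep (𝒢.rightRegular μ)) {Θ Θn Θτn : Set (𝒢.L2 μ)}
    (hΘ : Θ = {f : 𝒢.L2 μ | ∃ (i : 𝔓.ι) (Φ : 𝒢.Adelic → ℂ) (_ : Measurable Φ) (_ : ∀ (g : 𝒢.Adelic) (n : 𝔓.radical i), Φ (g * n) = Φ g)
        (_ : ∫⁻ x, (∑' q : 𝒢.quotientSubgroup ⧸ (𝔓.radical i).subgroupOf 𝒢.quotientSubgroup, ‖Φ ((Quotient.out x : 𝒢.Adelic) * ((q.out : 𝒢.quotientSubgroup) : 𝒢.Adelic))‖ₑ) ^ 2 ∂μ < ∞)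
        (hθ : MemLp (fun x : 𝒢.automorphicQuotient => ∑' q : 𝒢.quotientSubgroup ⧸ (𝔓.radical i).subgroupOf 𝒢.quotientSubgroup,
          Φ ((Quotient.out x : 𝒢.Adelic) * ((q.out : 𝒢.quotientSubgroup) : 𝒢.Adelic))) 2 μ), f = hθ.toLp _})
    (hΘn : Θn = {f : 𝒢.L2 μ | ∃ (i : 𝔓.ι) (Φ : 𝒢.Adelic → ℂ) (_ : Measurable Φ) (_ : ∀ (g : 𝒢.Adelic) (n : 𝔓.radical i), Φ (g * n) = Φ g)
        (_ : ∫⁻ x, (∑' q : 𝒢.quotientSubgroup ⧸ (𝔓.radical i).subgroupOf 𝒢.quotientSubgroup, ‖Φ ((Quotient.out x : 𝒢.Adelic) * ((q.out : 𝒢.quotientSubgroup) : 𝒢.Adelic))‖ₑ) ^ 2 ∂μ < ∞)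
        (_ : Continuous Φ) (_ : ∃ M : ℝ, ∀ g, ‖Φ g‖ ≤ M) (_ : ∃ C : Set 𝒢.Adelic, IsCompact C ∧ ∀ g, g ∉ C * ((𝔓.radical i : Subgroup 𝒢.Adelic) : Set 𝒢.Adelic) → Φ g = 0)
        (hθ : MemLp (fun x : 𝒢.automorphicQuotient => ∑' q : 𝒢.quotientSubgroup ⧸ (𝔓.radical i).subgroupOf 𝒢.quotientSubgroup,
          Φ ((Quotient.out x : 𝒢.Adelic) * ((q.out : 𝒢.quotientSubgroup) : 𝒢.Adelic))) 2 μ), f = hθ.toLp _})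
    (hΘτn : Θτn = {f : 𝒢.L2 μ | ∃ (i : 𝔓.ι) (Φ : 𝒢.Adelic → ℂ) (_ : Measurable Φ) (_ : ∀ (g : 𝒢.Adelic) (n : 𝔓.radical i), Φ (g * n) = Φ g)
        (_ : ∫⁻ x, (∑' q : 𝒢.quotientSubgroup ⧸ (𝔓.radical i).subgroupOf 𝒢.quotientSubgroup, ‖Φ ((Quotient.out x : 𝒢.Adelic) * ((q.out : 𝒢.quotientSubgroup) : 𝒢.Adelic))‖ₑ) ^ 2 ∂μ < ∞)
        (_ : Continuous Φ) (_ : ∃ M : ℝ, ∀ g, ‖Φ g‖ ≤ M) (_ : ∃ C : Set 𝒢.Adelic, IsCompact C ∧ ∀ g, g ∉ C * ((𝔓.radical i : Subgroup 𝒢.Adelic) : Set 𝒢.Adelic) → Φ g = 0)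
        (_ : ∀ (k : Kc) (h : 𝒢.Adelic), Φ (ι k * h) = (τ k)⁻¹ * Φ h)
        (hθ : MemLp (fun x : 𝒢.automorphicQuotient => ∑' q : 𝒢.quotientSubgroup ⧸ (𝔓.radical i).subgroupOf 𝒢.quotientSubgroup,
          Φ ((Quotient.out x : 𝒢.Adelic) * ((q.out : 𝒢.quotientSubgroup) : 𝒢.Adelic))) 2 μ), f = hθ.toLp _})
    (hE : (W.toSubmodule)ᗮ = (Submodule.span ℂ Θ).topologicalClosure) :
    (W.toSubmodule)ᗮ ⊓ (⨅ k, Module.End.eigenspace ((𝒢.rightRegular μ (ι k) : 𝒢.L2 μ →L[ℂ] 𝒢.L2 μ) : 𝒢.L2 μ →ₗ[ℂ] 𝒢.L2 μ) (τ k)) = (Submodule.span ℂ Θτn).topologicalClosure := by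
  have hu := 𝒢.isUnitary_rightRegular μ
  have hc : ((𝒢.rightRegular μ).restrict ι).IsStronglyContinuous := fun v => ((𝒢.isStronglyContinuous_rightRegular_holds μ) v).comp hι
  have hEW : (W.orthogonal hu).toSubmodule = (W.toSubmodule)ᗮ := ClosedSubrep.toSubmodule_orthogonal hu W
  -- `Θ ⊆ E`, `Θn ⊆ Θ ⊆ E`, and `E ≤ closure span Θn` (★ P1b §1)
  have hΘE : Θ ⊆ W.orthogonal hu := fun f hf => by
    show f ∈ (W.orthogonal hu).toSubmodule
    rw [hEW, hE]
    exact Submodule.le_topologicalClosure _ (Submodule.subset_span hf)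
  have hnΘ : Θn ⊆ Θ := fun f hf => by
    rw [hΘn] at hf
    obtain ⟨j, Φ, hΦm, hΦ, h2, -, -, -, hθ, rfl⟩ := hf
    rw [hΘ]; exact ⟨j, Φ, hΦm, hΦ, h2, hθ, rfl⟩
  have hSE : Θn ⊆ W.orthogonal hu := hnΘ.trans hΘE
  have hES : (W.orthogonal hu).toSubmodule ≤ (Submodule.span ℂ Θn).topologicalClosure := by
    rw [hEW, hE]; exact topologicalClosure_span_le_nice 𝒢 𝔓 μ ν hN hΘ hΘn
  have hF1 := inf_iInf_eigenspace_eq_topologicalClosure_span_image_tauAverage ι τ μK hu hc hτ hτc (W.orthogonal hu) hSE hES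
  rw [hEW] at hF1
  -- (a) the twisted average of a nice class is a nice `τ`-equivariant class
  have ha : ∀ f ∈ Θn, (∫ k, (τ k)⁻¹ • 𝒢.rightRegular μ (ι k) f ∂μK) ∈ Θτn := by
    intro f hf
    rw [hΘn] at hf
    obtain ⟨j, Φ, hΦm, hΦ, h2, hΦc, ⟨M, hM⟩, ⟨C, hC, hCΦ⟩, hθ, rfl⟩ := hf
    obtain ⟨hm, hN', h2', heq⟩ := integral_smul_rightRegular_toLp_pseudoEisenstein_eq 𝒢 𝔓 j μ μK ι τ hι hτ hτc hΦm hΦ h2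
    rw [hΘτn]
    refine ⟨j, fun h : 𝒢.Adelic => ∫ k, τ k * Φ (ι k * h) ∂μK, hm, hN', h2', continuous_tauAverage μK τ hι hτc hΦc, ⟨M, norm_tauAverage_le μK τ ι hτ hM⟩,
      ⟨(Set.range ι)⁻¹ * C, (isCompact_range hι).inv.mul hC, fun g hg => tauAverage_eq_zero_of_forall μK τ ι (S := C * ((𝔓.radical j : Subgroup 𝒢.Adelic) : Set 𝒢.Adelic)) hCΦ ?_⟩,
      fun k h => tauAverage_mul_left 𝒢 μK ι τ hτ Φ k h, memLp_two_pseudoEisenstein_automorphicQuotient 𝒢 𝔓 j μ hm hN' h2', heq⟩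
    rwa [← mul_assoc]
  -- (b) nice `τ`-equivariant classes are `τ`-vectors of `Wᗮ`
  have hb : Θτn ⊆ ((W.toSubmodule)ᗮ ⊓ (⨅ k, Module.End.eigenspace ((𝒢.rightRegular μ (ι k) : 𝒢.L2 μ →L[ℂ] 𝒢.L2 μ) : 𝒢.L2 μ →ₗ[ℂ] 𝒢.L2 μ) (τ k)) : Submodule ℂ (𝒢.L2 μ)) := by
    intro f hf
    rw [hΘτn] at hf
    obtain ⟨j, Φ, hΦm, hΦ, h2, -, -, -, hK, hθ, rfl⟩ := hf
    refine ⟨?_, toLp_pseudoEisenstein_mem_iInf_eigenspace_of_forall 𝒢 𝔓 j μ ι τ hΦm hΦ h2 hK⟩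
    rw [← hEW]
    exact hΘE (by rw [hΘ]; exact ⟨j, Φ, hΦm, hΦ, h2, hθ, rfl⟩)
  refine le_antisymm ?_ ?_
  · rw [hF1]
    refine Submodule.topologicalClosure_mono (Submodule.span_le.2 ?_)
    rintro _ ⟨f, hf, rfl⟩
    exact Submodule.subset_span (ha f hf)
  · refine Submodule.topologicalClosure_minimal _ (Submodule.span_le.2 hb) ?_
    rw [hF1]
    exact Submodule.isClosed_topologicalClosure _

end Head

end Summit.HodgeConjecture.HodgeConjecture.Cruxes.H413.K2E1PseudoEisensteinNiceGeneratorsKTypeU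

end
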